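import Summits.ValiantsHypothesis.ValiantsHypothesis.Theorems.KPlusLogSqLawTropicalBWalkHalving

/-!
# Route `KPlusLogSqLaw`, crux `TropicalB` — parametric shortest paths in LAYERED graphs: Gusfield's bound, width-explicit

HONEST FRAMING.  Helper file (seat val-sym-trop-p1 g4, cell `pub-symmetroid`, 2026-08-27) toward the registered stubs of
`Cruxes/TropicalB/Lines/birth.lean` (crux `TropicalB`, item `stmt-ValiantsHypothesis-19771`), on the WALK-DESIGN route of the `K = 4`
growth fork (`TropicalCensus.TropK4Law 2` vs `¬ TropK4Law 2`): a width-`W` layered family with `T` layers yields tropical census rows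
through `WalkDesign.le_of_walkSystem` on `m = (T+1)·W` nodes, and this file shows its parametric shortest-path envelope has at most
`(2W)^⌈log₂ T⌉` pieces — at width `≤ 3` that is `O(T^{log₂ 6})`, so a CUBIC-in-`m` family via walk systems needs width `≥ 4`
(the seat's K4-FORK-NOTE question; memo CUBIC-ARCHITECTURES-g4 §6 (iii)).  KNOWN MATHEMATICS (Gusfield 1980; the tree's
`Literature/Combinatorics/Optimization/ParametricShortestPath.lean` records the matching Carstensen lower bound and lists «Gusfield's
upper bound» as not held); nothing here is new, nothing bounds `TropicalB` in its window, nothing on `WeakLifting`, `MatrixDescartes`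
(`stmt-ValiantsHypothesis-18050`) or `VP ≠ VNP`.  Model: a layered graph of WIDTH `W` (`LayeredGraph W`: for
every layer index `t` and vertices `x, y : Fin W` an optional arc `(t, x) → (t+1, y)` costing `wa + wb · μ`); walks of `ℓ`
arcs from layer `t₀` (`LWalk`, with `src`, `dst`, cost line `icpt + slope · μ`), restriction to the first `ℓ₁` / last `ℓ₂`
arcs (`fst`, `snd`: the line is the sum, `icpt_eq_add` / `slope_eq_add`) and concatenation (`glue`, `fst_glue`, `snd_glue`).

* **`chainBound_walkFam`** — for walks of `ℓ ≤ 2^k` arcs between two fixed vertices, every chain of cheapest walks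
  (parameters increasing, slopes strictly decreasing) has at most `(2W)^k` members; **`chainBound_walkFam_clog`** — at most
  `(2W)^⌈log₂ ℓ⌉`.  So the parametric shortest-path cost between two vertices has at most `(2W)^⌈log₂ ℓ⌉` linear pieces:
  `n^{O(log n)}` for `W, ℓ ≤ n` (Gusfield; every DAG on `n` topologically ordered vertices is a layered graph of width `n`
  with `n − 1` layers after adding cost-free «stay» arcs), and for BOUNDED width a polynomial in the length of degree
  `log₂(2W)` — `ℓ²` at width `2`, `ℓ^{log₂ 6} < ℓ^{2.59}` at width `3`, `ℓ³` at width `4`.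
  Proof: induction on `k` with the halving inequality `ParamLines.chainBound_glue` (middle states = the `W` vertices of the
  middle layer; `W · (2·(2W)^k − 1) ≤ (2W)^{k+1}`); base `ℓ ≤ 1`: walks with fixed endpoints have one slope.

What is NOT here: the identification with `ParametricShortestPath.ParamDAG` paths / `IsBreakpoint` (the layered graphs
`ParamDAG.ofLayers` of that file have the same walks; a breakpoint count is one less than a chain length), and matching
lower bounds for bounded width.

References: D. Gusfield, PhD thesis, UC Berkeley 1980 (via K. Gajjar, J. Radhakrishnan, FOCS 2019, p. 2: «Gusfield proved
an upper bound of `n^{O(log n)}`»); P. J. Carstensen, Math. Programming 26 (1983).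
-/

set_option linter.dupNamespace false
set_option autoImplicit false

namespace Summit.ValiantsHypothesis.ValiantsHypothesis.Theorems.KPlusLogSqLaw

/-! ## 3. Layered graphs of width `W`: walks, restriction and concatenation -/

/-- A LAYERED parametric graph of width `W`: for every layer index `t : ℕ` and vertices `x, y : Fin W` an optional arc
from `(t, x)` to `(t+1, y)` (`adj t x y`) with cost `wa t x y + wb t x y · μ`.  Only the layers actually traversed by a
walk matter. [folklore] -/
structure LayeredGraph (W : ℕ) where
  /-- arc predicate between consecutive layers -/
  adj : ℕ → Fin W → Fin W → Prop
  /-- intercepts of the arcs -/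
  wa : ℕ → Fin W → Fin W → ℝ
  /-- slopes of the arcs -/
  wb : ℕ → Fin W → Fin W → ℝ

namespace LayeredGraph

variable {W : ℕ} (G : LayeredGraph W)

/-- A walk of `ℓ` arcs starting in layer `t₀`: its vertex in each of the layers `t₀, …, t₀ + ℓ`. [folklore] -/
structure LWalk (t₀ ℓ : ℕ) where
  /-- the vertex sequence -/
  f : Fin (ℓ + 1) → Fin W
  /-- consecutive vertices are joined by arcs -/
  step : ∀ (i : ℕ) (h : i < ℓ), G.adj (t₀ + i) (f ⟨i, by omega⟩) (f ⟨i + 1, by omega⟩)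

variable {G} {t₀ ℓ ℓ₁ ℓ₂ : ℕ}

namespace LWalk

/-- first vertex. [folklore] -/
def src (p : G.LWalk t₀ ℓ) : Fin W := p.f ⟨0, by omega⟩

/-- last vertex. [folklore] -/
def dst (p : G.LWalk t₀ ℓ) : Fin W := p.f ⟨ℓ, by omega⟩

/-- intercept of the cost line of a walk (sum of the arc intercepts). [folklore] -/
def icpt (p : G.LWalk t₀ ℓ) : ℝ := ∑ i : Fin ℓ, G.wa (t₀ + i) (p.f ⟨i, by omega⟩) (p.f ⟨i + 1, by omega⟩)

/-- slope of the cost line of a walk (sum of the arc slopes). [folklore] -/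
def slope (p : G.LWalk t₀ ℓ) : ℝ := ∑ i : Fin ℓ, G.wb (t₀ + i) (p.f ⟨i, by omega⟩) (p.f ⟨i + 1, by omega⟩)

/-- a walk is determined by its vertex sequence. [folklore] -/
theorem ext {p q : G.LWalk t₀ ℓ} (h : p.f = q.f) : p = q := by
  cases p; cases q; cases h; rfl

/-- the first `ℓ₁` arcs of a walk of `ℓ₁ + ℓ₂` arcs. [folklore] -/
def fst (p : G.LWalk t₀ (ℓ₁ + ℓ₂)) : G.LWalk t₀ ℓ₁ where
  f i := p.f ⟨i.1, by omega⟩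
  step i h := p.step i (by omega)

/-- the last `ℓ₂` arcs of a walk of `ℓ₁ + ℓ₂` arcs (a walk starting in layer `t₀ + ℓ₁`). [folklore] -/
def snd (p : G.LWalk t₀ (ℓ₁ + ℓ₂)) : G.LWalk (t₀ + ℓ₁) ℓ₂ where
  f i := p.f ⟨ℓ₁ + i.1, by omega⟩
  step i h := by
    have := p.step (ℓ₁ + i) (by omega)
    rw [show t₀ + ℓ₁ + i = t₀ + (ℓ₁ + i) from Nat.add_assoc _ _ _]
    exact this

/-- restriction keeps the first vertex. [folklore] -/
theorem src_fst (p : G.LWalk t₀ (ℓ₁ + ℓ₂)) : p.fst.src = p.src := rfl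

/-- restriction keeps the last vertex. [folklore] -/
theorem dst_snd (p : G.LWalk t₀ (ℓ₁ + ℓ₂)) : (p.snd : G.LWalk (t₀ + ℓ₁) ℓ₂).dst = p.dst := by
  simp only [dst, snd]

/-- the two parts of a walk meet in the middle layer. [folklore] -/
theorem dst_fst (p : G.LWalk t₀ (ℓ₁ + ℓ₂)) : p.fst.dst = (p.snd : G.LWalk (t₀ + ℓ₁) ℓ₂).src := by
  simp only [dst, src, fst, snd, Nat.add_zero]

/-- the cost line of a walk is the sum of the cost lines of its two parts: intercepts. [folklore] -/
theorem icpt_eq_add (p : G.LWalk t₀ (ℓ₁ + ℓ₂)) : p.icpt = p.fst.icpt + (p.snd : G.LWalk (t₀ + ℓ₁) ℓ₂).icpt := by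
  unfold icpt
  rw [Fin.sum_univ_add]
  congr 1
  refine Finset.sum_congr rfl fun i _ => ?_
  simp only [snd, Fin.val_natAdd, Nat.add_assoc]

/-- the cost line of a walk is the sum of the cost lines of its two parts: slopes. [folklore] -/
theorem slope_eq_add (p : G.LWalk t₀ (ℓ₁ + ℓ₂)) : p.slope = p.fst.slope + (p.snd : G.LWalk (t₀ + ℓ₁) ℓ₂).slope := by
  unfold slope
  rw [Fin.sum_univ_add]
  congr 1
  refine Finset.sum_congr rfl fun i _ => ?_
  simp only [snd, Fin.val_natAdd, Nat.add_assoc]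

/-- concatenation of a walk of `ℓ₁` arcs with a walk of `ℓ₂` arcs starting where the first one ends. [folklore] -/
def glue (p : G.LWalk t₀ ℓ₁) (q : G.LWalk (t₀ + ℓ₁) ℓ₂) (h : p.dst = q.src) : G.LWalk t₀ (ℓ₁ + ℓ₂) where
  f i := if hi : i.1 ≤ ℓ₁ then p.f ⟨i.1, by omega⟩ else q.f ⟨i.1 - ℓ₁, by omega⟩
  step i hi := by
    by_cases h1 : i + 1 ≤ ℓ₁
    · have e1 : (if hi' : i ≤ ℓ₁ then p.f ⟨i, by omega⟩ else q.f ⟨i - ℓ₁, by omega⟩) = p.f ⟨i, by omega⟩ :=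
        dif_pos (by omega)
      have e2 : (if hi' : i + 1 ≤ ℓ₁ then p.f ⟨i + 1, by omega⟩ else q.f ⟨i + 1 - ℓ₁, by omega⟩) =
          p.f ⟨i + 1, by omega⟩ := dif_pos h1
      rw [e1, e2]
      exact p.step i (by omega)
    · -- both endpoints are read off `q` (at `i = ℓ₁` through `h`)
      have e1 : (if hi' : i ≤ ℓ₁ then p.f ⟨i, by omega⟩ else q.f ⟨i - ℓ₁, by omega⟩) = q.f ⟨i - ℓ₁, by omega⟩ := by
        by_cases h0 : i ≤ ℓ₁
        · rw [dif_pos h0]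
          have hi0 : i = ℓ₁ := by omega
          subst hi0
          have : (⟨i - i, by omega⟩ : Fin (ℓ₂ + 1)) = ⟨0, by omega⟩ := Fin.ext (by simp)
          rw [this]
          exact h
        · rw [dif_neg h0]
      have e2 : (if hi' : i + 1 ≤ ℓ₁ then p.f ⟨i + 1, by omega⟩ else q.f ⟨i + 1 - ℓ₁, by omega⟩) =
          q.f ⟨i - ℓ₁ + 1, by omega⟩ := by
        rw [dif_neg h1]
        congr 1
        exact Fin.ext (by simp only; omega)
      rw [e1, e2]
      have := q.step (i - ℓ₁) (by omega)
      have et : t₀ + ℓ₁ + (i - ℓ₁) = t₀ + i := by omega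
      rwa [et] at this

/-- the first part of a concatenation. [folklore] -/
theorem fst_glue (p : G.LWalk t₀ ℓ₁) (q : G.LWalk (t₀ + ℓ₁) ℓ₂) (h : p.dst = q.src) : (glue p q h).fst = p := by
  apply ext
  funext i
  simp only [fst, glue]
  rw [dif_pos (by omega)]

/-- the second part of a concatenation. [folklore] -/
theorem snd_glue (p : G.LWalk t₀ ℓ₁) (q : G.LWalk (t₀ + ℓ₁) ℓ₂) (h : p.dst = q.src) :
    ((glue p q h).snd : G.LWalk (t₀ + ℓ₁) ℓ₂) = q := by
  apply ext
  funext i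
  obtain ⟨iv, hiv⟩ := i
  simp only [snd, glue]
  by_cases h0 : ℓ₁ + iv ≤ ℓ₁
  · rw [dif_pos h0]
    have hi : iv = 0 := by omega
    subst hi
    exact h
  · rw [dif_neg h0]
    congr 1
    exact Fin.ext (by simp)

/-- walks of length `0` or `1` with prescribed endpoints all have the same slope. [folklore] -/
theorem slope_eq_of_le_one (hℓ : ℓ ≤ 1) (p q : G.LWalk t₀ ℓ) (hs : p.src = q.src) (hd : p.dst = q.dst) :
    p.slope = q.slope := by
  unfold slope
  refine Finset.sum_congr rfl fun i _ => ?_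
  have hℓ1 : ℓ = 1 := by have := i.2; omega
  subst hℓ1
  have hi : i = ⟨0, by omega⟩ := Fin.ext (by have := i.2; omega)
  subst hi
  simp only [src, dst] at hs hd
  simp only [Nat.zero_add]
  rw [show p.f ⟨0, by omega⟩ = q.f ⟨0, by omega⟩ from hs, show p.f ⟨1, by omega⟩ = q.f ⟨1, by omega⟩ from hd]

end LWalk

/-! ## 4. Gusfield's bound: chains of cheapest walks of length `ℓ ≤ 2^k` have at most `(2W)^k` members -/

open ParamLines Finset

/-- the line family of walks of `ℓ` arcs from `(t₀, x)` to `(t₀ + ℓ, y)`. [folklore] -/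
abbrev WalkFam (G : LayeredGraph W) (t₀ ℓ : ℕ) (x y : Fin W) : Type := {p : G.LWalk t₀ ℓ // p.src = x ∧ p.dst = y}

/-- **GUSFIELD'S HALVING BOUND (width-explicit).**  In a layered graph of width `W`, every chain of cheapest walks of
`ℓ ≤ 2^k` arcs between two fixed vertices — parameters `μ₀ < ⋯ < μₙ`, walk `pⱼ` cheapest at `μⱼ`, slopes strictly decreasing —
has `n + 1 ≤ (2W)^k` members.  Equivalently the parametric shortest-path cost between the two vertices, a concave piecewise
linear function of `μ`, has at most `(2W)^{⌈log₂ ℓ⌉}` linear pieces: `W^{O(log ℓ)}`, Gusfield's `n^{O(log n)}` for `W, ℓ ≤ n`;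
for bounded width `W` a POLYNOMIAL of degree `log₂(2W)` in the length (`ℓ²` at width 2, `ℓ^{log₂ 6}` at width 3, `ℓ³` at
width 4). [cite: Gusfield1980, n^{O(log n)} upper bound (via GajjarRadhakrishnan2019 p. 2)] -/
theorem chainBound_walkFam (G : LayeredGraph W) (k : ℕ) :
    ∀ (t₀ ℓ : ℕ) (x y : Fin W), ℓ ≤ 2 ^ k →
      ChainBound (fun p : G.WalkFam t₀ ℓ x y => p.1.icpt) (fun p => p.1.slope) ((2 * W) ^ k) := by
  induction k with
  | zero =>
    intro t₀ ℓ x y hℓ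
    rw [pow_zero]
    exact chainBound_one_of_subsingleton _ _ fun p q =>
      LWalk.slope_eq_of_le_one (by simpa using hℓ) p.1 q.1 (p.2.1.trans q.2.1.symm) (p.2.2.trans q.2.2.symm)
  | succ k ih =>
    intro t₀ ℓ x y hℓ
    rcases Nat.eq_zero_or_pos W with hW | hW
    · -- no vertices: no walks, no chains
      subst hW
      intro n μ z _ _ _
      exact (z 0).1.src.elim0
    by_cases hsmall : ℓ ≤ 2 ^ k
    · exact (ih t₀ ℓ x y hsmall).mono (Nat.pow_le_pow_left (le_refl _) _ |>.trans (Nat.pow_le_pow_right (by omega) (Nat.le_succ k)))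
    -- split `ℓ = ℓ₁ + ℓ₂` with both halves `≤ 2^k`
    obtain ⟨ℓ₁, ℓ₂, rfl, h₁, h₂⟩ : ∃ ℓ₁ ℓ₂, ℓ = ℓ₁ + ℓ₂ ∧ ℓ₁ ≤ 2 ^ k ∧ ℓ₂ ≤ 2 ^ k :=
      ⟨ℓ / 2, ℓ - ℓ / 2, by omega, by rw [pow_succ] at hℓ; omega, by rw [pow_succ] at hℓ; omega⟩
    -- glue data
    have hglue := chainBound_glue (ι := G.WalkFam t₀ (ℓ₁ + ℓ₂) x y)
      (X := {p : G.LWalk t₀ ℓ₁ // p.src = x}) (Y := {q : G.LWalk (t₀ + ℓ₁) ℓ₂ // q.dst = y}) (W := Fin W)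
      (fun p => p.1.icpt) (fun p => p.1.slope) (fun p => p.1.icpt) (fun p => p.1.slope) (fun q => q.1.icpt)
      (fun q => q.1.slope) (fun p => ⟨p.1.fst, p.2.1⟩) (fun p => ⟨p.1.snd, by rw [LWalk.dst_snd]; exact p.2.2⟩)
      (fun p => p.1.dst) (fun q => q.1.src) (fun p => LWalk.dst_fst p.1) (fun p => LWalk.icpt_eq_add p.1)
      (fun p => LWalk.slope_eq_add p.1)
      (fun p q hpq => ⟨⟨LWalk.glue p.1 q.1 hpq, by
          refine ⟨?_, ?_⟩
          · rw [← LWalk.src_fst, LWalk.fst_glue]; exact p.2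
          · rw [← LWalk.dst_snd, LWalk.snd_glue]; exact q.2⟩,
        Subtype.ext (LWalk.fst_glue p.1 q.1 hpq), Subtype.ext (LWalk.snd_glue p.1 q.1 hpq)⟩)
      (fun _ => (2 * W) ^ k) (fun _ => (2 * W) ^ k)
      (fun w => (ih t₀ ℓ₁ x w h₁).of_surjLines (fun p => ⟨p.1.1, p.1.2, p.2⟩) (fun _ => rfl) (fun _ => rfl)
        (fun q => ⟨⟨⟨q.1, q.2.1⟩, q.2.2⟩, rfl⟩))
      (fun w => (ih (t₀ + ℓ₁) ℓ₂ w y h₂).of_surjLines (fun q => ⟨q.1.1, q.2, q.1.2⟩) (fun _ => rfl) (fun _ => rfl)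
        (fun q => ⟨⟨⟨q.1, q.2.2⟩, q.2.1⟩, rfl⟩))
    refine hglue.mono ?_
    -- `Σ_w (2 N − 1) = W (2 N − 1) ≤ (2W)^(k+1)`
    rw [Finset.sum_const, Finset.card_univ, Fintype.card_fin, smul_eq_mul, pow_succ]
    have : (2 * W) ^ k + (2 * W) ^ k - 1 ≤ (2 * W) ^ k * 2 := by omega
    calc W * ((2 * W) ^ k + (2 * W) ^ k - 1) ≤ W * ((2 * W) ^ k * 2) := Nat.mul_le_mul_left _ this
      _ = (2 * W) ^ k * (2 * W) := by ring

/-- **Gusfield's bound at the natural exponent.**  Chains of cheapest walks of `ℓ` arcs in a layered graph of width `W` have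
at most `(2W)^⌈log₂ ℓ⌉` members (`Nat.clog 2 ℓ = ⌈log₂ ℓ⌉`). [cite: Gusfield1980, n^{O(log n)} upper bound (via
GajjarRadhakrishnan2019 p. 2)] -/
theorem chainBound_walkFam_clog (G : LayeredGraph W) (t₀ ℓ : ℕ) (x y : Fin W) :
    ChainBound (fun p : G.WalkFam t₀ ℓ x y => p.1.icpt) (fun p => p.1.slope) ((2 * W) ^ Nat.clog 2 ℓ) :=
  chainBound_walkFam G (Nat.clog 2 ℓ) t₀ ℓ x y (Nat.le_pow_clog (by norm_num) ℓ)

end LayeredGraph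

end Summit.ValiantsHypothesis.ValiantsHypothesis.Theorems.KPlusLogSqLaw
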